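import Literature.NumberTheory.EllipticCurves.TateCurve.TorsionRoot
import Literature.NumberTheory.EllipticCurves.TateCurve.NumberField
import HarnessLib

/-!
# Rational `n`-torsion at a place of split multiplicative reduction forces `q_v = rⁿ`
# (number-field corollary of `TorsionRoot.lean`; [IUTchI] Ex. 3.2 (iv) "`q_v` admits a `2l`-th root in `K_v̲`")

Topic `Literature/NumberTheory/EllipticCurves/TateCurve`, namespace
`Literature.NumberTheory.EllipticCurves.TateCurve`; proof-only (cell abc-iut, seat abc-iut-w5-d209; classical).
Instantiates `exists_pow_eq_of_torsion_of_variableChange` (`TorsionRoot.lean`) at the completion `F_v` of a number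
field at a finite place of SPLIT multiplicative reduction, where the tree's UNCONDITIONAL Silverman ATAEC V.5.3
(`exists_tateParameter_valuation_of_hasSplitMultiplicativeReductionAt`, `NumberField.lean`) supplies the
`F_v`-isomorphism with the Tate curve. Inside the proof `F_v` is viewed as a `NontriviallyNormedField` through the
tree's reducible `…Ultrametric.AdicCompletion.nontriviallyNormedField` (definitionally the registered norm; no
instance is declared here).

* `exists_pow_eq_tateParameter_of_torsion_at` — `W/F` elliptic, `W.HasSplitMultiplicativeReductionAt v`, `0 < n`, a
  `Finset` of `n²` points of `W` over `F_v` killed by `n` ⇒ `∃ q r : F_v`, `q ≠ 0`, `‖q‖ < 1`, `tateJ q = j(W)`,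
  `rⁿ = q`, `v(j(W)) = (v r)⁻¹ ^ n` (so `n ∣ ord_v(q_v) = −ord_v(j(W))`).

With `n = 2` ([IUTchI] Def. 3.1 (b): `E_F[2] ⊆ E_F(F)`) and `n = l` (Def. 3.1 (c): `K := F(E_F[l])`) combined by
`exists_pow_mul_eq_of_coprime`, this is the `2l`-th root `q̲_v` of [IUTchI] Ex. 3.2 (iv) — GIVEN split multiplicative
reduction over `K_v̲` and the torsion count, which are the consumer's inputs (not derived here).

## References
* [SilvermanATAEC1994] J. H. Silverman, *Advanced Topics in the Arithmetic of Elliptic Curves*, GTM 151,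
  Springer 1994, Thm. V.3.1 (c)(d) (PDF p. 395), Thm. V.5.3 (PDF pp. 407–409).
-/

noncomputable section

open scoped Classical

namespace Literature.NumberTheory.EllipticCurves.TateCurve

open WeierstrassCurve SteinWuthrich2013

/-! ### At a finite place of split multiplicative reduction -/

section NumberField

open IsDedekindDomain

variable (F : Type) [Field F] [NumberField F] (v : HeightOneSpectrum (NumberField.RingOfIntegers F))

/-- **At a place of SPLIT multiplicative reduction, `n²` rational `n`-torsion points force `q_v = rⁿ`**
(hence `n ∣ ord_v(q_v) = −ord_v(j)`): for `W/F` elliptic with the tree's `W.HasSplitMultiplicativeReductionAt v`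
and `n²` distinct `F_v`-points of `W` killed by `n` (`0 < n`), the Tate parameter `q_v ∈ F_v` of Silverman
ATAEC V.5.3 (`q_v ≠ 0`, `‖q_v‖ < 1`, `tateJ q_v = j(W)`) is `rⁿ` for some `r ∈ F_v`, and
`v(j(W)) = (v(r))⁻¹ ^ n`. With `n = 2` (from `E_F[2] ⊆ E_F(F)`, [IUTchI] Def. 3.1 (b)) and `n = l`
(from `K := F(E_F[l])`, Def. 3.1 (c)) combined by `exists_pow_mul_eq_of_coprime`, this is the `2l`-th root
`q̲_v` of [IUTchI] Ex. 3.2 (iv) — GIVEN split multiplicative reduction over the completion.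
[cite: SilvermanATAEC1994, Thm. V.5.3 (PDF pp. 407–409)] -/
theorem exists_pow_eq_tateParameter_of_torsion_at (W : WeierstrassCurve F) [W.IsElliptic]
    (h : W.HasSplitMultiplicativeReductionAt v) {n : ℕ} (hn : 0 < n)
    (S : Finset (W.baseChange (v.adicCompletion F)).toAffine.Point) (hS : ∀ P ∈ S, n • P = 0)
    (hcard : n ^ 2 ≤ S.card) :
    ∃ q r : v.adicCompletion F, q ≠ 0 ∧ ‖q‖ < 1 ∧
      tateJ q = algebraMap F (v.adicCompletion F) W.j ∧ r ^ n = q ∧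
      Valued.v (algebraMap F (v.adicCompletion F) W.j) = ((Valued.v r)⁻¹) ^ n := by
  letI := Literature.NumberTheory.GaloisRepresentations.Ultrametric.AdicCompletion.nontriviallyNormedField F v
  haveI := charZero_adicCompletion' F v
  obtain ⟨q, hq0, hq, hqj, hqv, C, hC⟩ :=
    exists_tateParameter_valuation_of_hasSplitMultiplicativeReductionAt F v W h
  have hqn : ‖q‖ < 1 := Valued.toNormedField.norm_lt_one_iff.mpr hq
  obtain ⟨r, hr⟩ :=
    exists_pow_eq_of_torsion_of_variableChange (W.baseChange (v.adicCompletion F)) hq0 hqn C hC hn S hS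
      hcard
  refine ⟨q, r, hq0, hqn, hqj, hr, ?_⟩
  rw [← inv_inv (Valued.v (algebraMap F (v.adicCompletion F) W.j)), ← hqv, ← hr, map_pow, inv_pow]

end NumberField

end Literature.NumberTheory.EllipticCurves.TateCurve

end
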